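import Summits.SmoothPoincare4.SmoothPoincare4.Theorems.DottedCircleRasmussenDcrGapHelperFriendsCarrierTkAux14

/-!
# Helper `helper_friendsCarrier_Tk_endCompact` of stub `helper_friendsCarrier_Tk` — the end collar, part 9: the compactness clause
(item stmt-SmoothPoincare4-16128, route route-SmoothPoincare4-DottedCircleRasmussen)

Continuation of `…TkAux8–14` (end collar, parts 1–7), porting the second end clause of the tree's
`OpenTraceCollar.lean`: **`C ∪ c(Y × (-∞, a])` is compact** (the collar is proper towards the core).
A collar point of height `σ ≤ a` has size `N = e^{-σ} ≥ N₀ = e^{-a}`; in the radial/tube regimes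
`N = ρ(X)(ψ Y) ≤ max(X, ψ Y) + X/4` bounds the level `G_k` of the `0`-handle-chart point from above by
`1 + s(αof(N₀/4)) < 1 + δ` (so the point lies in `incl` of the compact sublevel set
`{guard ≥ 1/4, G_k ≤ 1 + s₀}`), unless `X < N₀/4`, when `ψ Y ≥ N₀/2` bounds the tube radius and the
point lies in `inr(𝔻² × univBall⁻¹ B̄(0, r₁))`; the cocore regime is bounded likewise.

* `EndDatum.SmoothPresentation.isCompact_trCore_union_image_le`;
* `helper_friendsCarrier_Tk_endCompact` — the registered summary.

Everything is proved; no named facts, no `sorry`.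
References: Kirby (1989), Ch. I §5 [Kirby1989]; the tree's `OpenTraceCollar.lean`, `TraceCollarProfile.lean`.
-/

-- the prescribed namespace `Summit.<P>.<Sub>.…` duplicates `SmoothPoincare4` (P = Sub)
set_option linter.dupNamespace false
set_option linter.style.longLine false

noncomputable section

open scoped Manifold ContDiff Topology
open Function Set Metric
open Literature.Topology.FourManifolds Literature.Topology.FourManifolds.MMSW

namespace Summit.SmoothPoincare4.SmoothPoincare4.Theorems.DcrGap.MkFriends

namespace FriendsTk

namespace EndDatum

variable {k : ℕ} (E : EndDatum k)

/-! ### Compact sublevel sets of the level function inside `P` -/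

/-- The sublevel set `A_s = {guard ≥ 1/4, G_k ≤ 1 + s}` (`s < 1`) is compact. [folklore] -/
theorem isCompact_sublevel {s : ℝ} (hs : s < 1) :
    IsCompact {y : EuclideanSpace ℝ (Fin 4) | (∀ j, (1 : ℝ) / 4 ≤ holeTerm k j y) ∧ levelFun k y ≤ 1 + s} := by
  refine Metric.isCompact_of_isClosed_isBounded ?_ ?_
  · exact (continuousOn_levelFun (r := k) (by norm_num : (0 : ℝ) < 1 / 4)).preimage_isClosed_of_isClosed
      (isClosed_guard (1 / 4)) isClosed_Iic
  · refine (isBounded_closedBall (x := (0 : EuclideanSpace ℝ (Fin 4))) (r := 2 * (40 * ((k : ℝ) + 1)) + 2)).subset fun y hy => ?_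
    rw [mem_closedBall_zero_iff]
    have hpos : ∀ j, 0 < holeTerm k j y := fun j => lt_of_lt_of_le (by norm_num) (hy.1 j)
    have h1 := FriendsH2.norm_sq_le_levelFun hpos
    have hR : (40 : ℝ) ≤ 40 * ((k : ℝ) + 1) := by nlinarith [(k.cast_nonneg : (0 : ℝ) ≤ k)]
    have h2 : ‖y‖ ^ 2 ≤ (2 * (40 * ((k : ℝ) + 1)) + 2) ^ 2 := by
      have : levelFun k y * ((40 * ((k : ℝ) + 1)) ^ 2 + 1) ≤ 2 * ((40 * ((k : ℝ) + 1)) ^ 2 + 1) :=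
        mul_le_mul_of_nonneg_right (by linarith [hy.2]) (by positivity)
      nlinarith
    exact (pow_le_pow_iff_left₀ (norm_nonneg y) (by positivity) two_ne_zero).1 h2

/-- The sublevel set `A_s` (`0 ≤ s < δ`) lies in `P`. [folklore] -/
theorem sublevel_subset_hbNbhd {s : ℝ} (hsδ : s < E.δ) :
    {y : EuclideanSpace ℝ (Fin 4) | (∀ j, (1 : ℝ) / 4 ≤ holeTerm k j y) ∧ levelFun k y ≤ 1 + s} ⊆ E.hbNbhd := fun y hy => by
  have hpos : ∀ j, 0 < holeTerm k j y := fun j => lt_of_lt_of_le (by norm_num) (hy.1 j)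
  have hδ1 := E.δ_lt_one
  exact ⟨fun j => FriendsH2.half_lt_holeTerm_of_levelFun_lt_two hpos (by linarith [hy.2]) j, by linarith [hy.2]⟩

/-- A lower bound `X₀ ≤ ξ(α)` on the handle radius of a band point bounds its level: `G_k y ≤ 1 + s(αof X₀)`. [folklore] -/
theorem levelFun_le_of_le_ξ {y : EuclideanSpace ℝ (Fin 4)} (hy : y ∈ E.hbNbhd) (h1 : 1 < levelFun k y) {X₀ : ℝ} (hX₀ : 0 < X₀)
    (hle : X₀ ≤ TraceCollar.ξ (E.radA y)) : levelFun k y ≤ 1 + E.collarTime (TraceCollar.αof X₀) := by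
  obtain ⟨hα, hα1⟩ := E.radA_mem_Ioo hy h1
  have hαX : TraceCollar.αof X₀ ≤ E.radA y := by
    by_contra h
    have := TubeNbhd.ξ_lt_ξ hα.le (not_le.1 h) (TraceCollar.αof_lt_one _)
    rw [TraceCollar.ξ_αof] at this
    linarith
  have h := (E.collarTime_le_collarTime_iff hα.le (TraceCollar.αof_pos hX₀).le).2 hαX
  rw [E.collarTime_radA hy h1] at h
  linarith

namespace SmoothPresentation

variable {E} {Y : Type*} [TopologicalSpace Y] [ChartedSpace (EuclideanSpace ℝ (Fin 3)) Y] (P : E.SmoothPresentation Y)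

/-- **End clause 2**: `C ∪ c(Y × (-∞, a])` is compact (the collar is proper towards the core). [folklore] -/
theorem isCompact_trCore_union_image_le (a : ℝ) : IsCompact (E.trCore ∪ E.collar P.jM P.jB P.ψ '' {p | p.2 ≤ a}) := by
  -- constants
  set N₀ : ℝ := Real.exp (-a) with hN₀
  have hN₀pos : 0 < N₀ := Real.exp_pos _
  set s₁ : ℝ := E.collarTime (TraceCollar.αof N₀) with hs₁
  set s₂ : ℝ := E.collarTime (TraceCollar.αof (N₀ / 4)) with hs₂
  have hα₁ : 0 < TraceCollar.αof N₀ := TraceCollar.αof_pos hN₀pos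
  have hα₂ : 0 < TraceCollar.αof (N₀ / 4) := TraceCollar.αof_pos (by positivity)
  have hs₁0 : 0 ≤ s₁ := (E.collarTime_nonneg_iff hα₁.le).2 (TraceCollar.αof_lt_one _).le
  have hs₁δ : s₁ < E.δ := (E.collarTime_mem_Ioo hα₁).2
  have hs₂δ : s₂ < E.δ := (E.collarTime_mem_Ioo hα₂).2
  set s₀ : ℝ := max s₁ s₂ with hs₀
  have hs₀δ : s₀ < E.δ := max_lt hs₁δ hs₂δ
  have hs₀0 : 0 ≤ s₀ := hs₁0.trans (le_max_left _ _)
  set Y₁ : ℝ := TraceCollar.ψinv (N₀ / 2) with hY₁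
  have hY₁pos : 0 < Y₁ := TraceCollar.ψinv_pos _
  have hψY₁ : TraceCollar.ψ Y₁ = N₀ / 2 := TraceCollar.ψ_ψinv (by positivity)
  set r₁ : ℝ := 2 * Real.exp (-Y₁) with hr₁
  have hr₁pos : 0 < r₁ := by positivity
  have hr₁2 : r₁ < 2 := by
    have : Real.exp (-Y₁) < 1 := Real.exp_lt_one_iff.2 (by linarith)
    simp only [hr₁]; linarith
  set κ := OpenPartialHomeomorph.univBall (0 : EuclideanSpace ℝ (Fin 2)) 2 with hκ
  -- the compact set
  set A : Set (EuclideanSpace ℝ (Fin 4)) := {y | (∀ j, (1 : ℝ) / 4 ≤ holeTerm k j y) ∧ levelFun k y ≤ 1 + s₀} with hA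
  have hAsub : A ⊆ E.hbNbhd := E.sublevel_subset_hbNbhd hs₀δ
  have hAc : IsCompact A := isCompact_sublevel (hs₀δ.trans E.δ_lt_one)
  set K : Set E.Trace := E.incl '' A ∪
    E.trGlueData.inr '' (Metric.closedBall (0 : EuclideanSpace ℝ (Fin 2)) 1 ×ˢ (κ.symm '' Metric.closedBall (0 : EuclideanSpace ℝ (Fin 2)) r₁)) with hK
  have hKc : IsCompact K := by
    refine (hAc.image_of_continuousOn (E.contMDiffOn_incl.continuousOn.mono hAsub)).union
      (((isCompact_closedBall _ _).prod ?_).image E.trGlueData.continuous_inr)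
    refine (isCompact_closedBall _ _).image_of_continuousOn (κ.continuousOn_symm.mono ?_)
    rw [hκ, OpenPartialHomeomorph.univBall_target _ (by norm_num : (0 : ℝ) < 2)]
    exact Metric.closedBall_subset_ball hr₁2
  -- closedness: the complement is `c(Y × (a, ∞))`
  have hclosed : IsClosed (E.trCore ∪ E.collar P.jM P.jB P.ψ '' {p | p.2 ≤ a}) := by
    have heq : (E.trCore ∪ E.collar P.jM P.jB P.ψ '' {p | p.2 ≤ a})ᶜ = E.collar P.jM P.jB P.ψ '' {p | a < p.2} := by
      ext z
      constructor
      · intro hz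
        have hC : z ∉ E.trCore := fun h => hz (Or.inl h)
        have hle : z ∉ E.collar P.jM P.jB P.ψ '' {p | p.2 ≤ a} := fun h => hz (Or.inr h)
        obtain ⟨p, rfl⟩ : z ∈ range (E.collar P.jM P.jB P.ψ) := by rw [P.range_collar]; exact hC
        exact ⟨p, show a < p.2 from not_le.1 fun h => hle ⟨p, h, rfl⟩, rfl⟩
      · rintro ⟨p, hp, rfl⟩ (hC | ⟨p', hp', hpp'⟩)
        · exact P.collar_not_mem_trCore p hC
        · rw [P.collar_injective hpp'] at hp'
          exact (not_le.2 (show a < p.2 from hp)) hp'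
    rw [← isOpen_compl_iff, heq]
    exact P.isOpen_image_collar (isOpen_lt continuous_const continuous_snd)
  refine hKc.of_isClosed_subset hclosed ?_
  -- the inclusion
  rintro z (hz | ⟨p, hp, rfl⟩)
  · -- the core lies in `K`
    rcases hz with ⟨y, hy, rfl⟩ | ⟨x, hx, rfl⟩
    · exact Or.inl ⟨y, ⟨fun j => le_trans (by norm_num) (hy.1 j), by linarith [hy.2]⟩, rfl⟩
    · refine Or.inr ⟨(x, 0), ⟨hx, ⟨0, by simp [hr₁pos.le], ?_⟩⟩, rfl⟩
      exact TubeNbhd.univBall_symm_zero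
  · -- a collar point of height `σ ≤ a` has size `N = e^{-σ} ≥ N₀`
    have hC : E.collar P.jM P.jB P.ψ p ∉ E.trCore := P.collar_not_mem_trCore p
    have hσ : (E.collarInv P.jM P.jB (E.collar P.jM P.jB P.ψ p)).2 = p.2 := by rw [P.collarInv_collar]
    have hN : N₀ ≤ Real.exp (-(E.collarInv P.jM P.jB (E.collar P.jM P.jB P.ψ p)).2) := by
      rw [hσ]; exact Real.exp_le_exp.2 (by simpa using hp)
    rcases E.exists_of_not_mem_trCore hC with ⟨y, hy, h1, h2, hyz⟩ | ⟨w, hw, hwz⟩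
    · rw [← hyz] at hN ⊢
      obtain ⟨hα, hα1, hdropM, hrange, hyeq⟩ := E.offCore_coords hy h1 h2
      have hX : 0 < TraceCollar.ξ (E.radA y) := TraceCollar.ξ_pos hα hα1
      have hguard : ∀ j, (1 : ℝ) / 4 ≤ holeTerm k j y := fun j => le_trans (by norm_num) (hy.1 j).le
      by_cases hc : E.dropA y ∈ E.closedTube
      · -- tube branch: `N = ρ X (ψ Y) ≤ max X (ψ Y) + X/4`
        obtain ⟨⟨u, w⟩, ⟨-, hw2⟩, hq⟩ := hc
        rw [Metric.mem_closedBall, dist_zero_right] at hw2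
        have hw : w ≠ 0 := fun h0 => hrange (by rw [← hq, h0]; exact E.ν₀_mem_range_iff.2 rfl)
        have hwpos : 0 < ‖w‖ := norm_pos_iff.2 hw
        have hYy : 0 ≤ Real.log (2 / ‖w‖) := Real.log_nonneg ((le_div_iff₀ hwpos).2 (by linarith))
        rw [E.collarInv_incl_of_mem P.jM P.jB hy ⟨(u, w), ⟨mem_univ _, by simpa using hw2⟩, hq⟩, ΨTube] at hN
        simp only [neg_neg] at hN
        have hΩ : (TraceCollar.ξ (E.radA y), Real.log (2 / ‖(E.ι₀ (E.dropA y)).2‖)) ∈ TraceCollar.Ωpos := hX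
        have hNpos : 0 < (E.profP y).1 := (TraceCollar.Φ_mem_Quad hΩ).1
        rw [Real.exp_log hNpos, profP, ← hq, E.ι₀_ν₀, TraceCollar.Φ, TraceCollar.Nf_of_pos hX] at hN
        have hρ := TraceCollar.ρ_le hX (TraceCollar.ψ (Real.log (2 / ‖w‖)))
        simp only at hN
        by_cases hXb : N₀ / 4 ≤ TraceCollar.ξ (E.radA y)
        · refine Or.inl ⟨y, ⟨hguard, ?_⟩, rfl⟩
          exact (E.levelFun_le_of_le_ξ hy h1 (by positivity) hXb).trans (by simp only [hs₀]; linarith [le_max_right s₁ s₂])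
        · rw [not_le] at hXb
          have hψb : N₀ / 2 ≤ TraceCollar.ψ (Real.log (2 / ‖w‖)) := by
            by_contra h
            rw [not_le] at h
            have : max (TraceCollar.ξ (E.radA y)) (TraceCollar.ψ (Real.log (2 / ‖w‖))) < N₀ / 2 := max_lt (by linarith) h
            linarith
          have hYb : Y₁ ≤ Real.log (2 / ‖w‖) := by
            by_contra h
            rw [not_le] at h
            have := TraceCollar.strictMonoOn_ψ hYy hY₁pos.le h
            linarith
          have hwr : ‖w‖ ≤ r₁ := by
            rw [← TubeNbhd.two_mul_exp_neg_log hwpos, hr₁]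
            gcongr
          -- rewrite the point in the handle chart
          have hyeq' : y = E.θ (E.collarTime (E.radA y), E.ν₀ (u, ‖w‖ • ((radialProjection (spherePt 1) w :
              Metric.sphere (0 : EuclideanSpace ℝ (Fin 2)) 1) : EuclideanSpace ℝ (Fin 2)))) := by
            rw [norm_smul_coe_radialProjection, hq]; exact hyeq
          have hpt : E.incl y = E.trGlueData.inr (E.radA y • (u : EuclideanSpace ℝ (Fin 2)),
              κ.symm (‖w‖ • ((radialProjection (spherePt 1) w : Metric.sphere (0 : EuclideanSpace ℝ (Fin 2)) 1) : EuclideanSpace ℝ (Fin 2)))) := by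
            conv_lhs => rw [hyeq']
            exact E.ptT_eq_inr hα hwpos (hwr.trans_lt hr₁2) u _
          rw [hpt]
          refine Or.inr ⟨_, ⟨?_, ⟨w, ?_, ?_⟩⟩, rfl⟩
          · rw [Metric.mem_closedBall, dist_zero_right, norm_smul_coe_sphere hα.le]; exact hα1.le
          · rw [Metric.mem_closedBall, dist_zero_right]; exact hwr
          · rw [norm_smul_coe_radialProjection]
      · -- radial branch: `N = ξ(α)`
        rw [E.collarInv_incl_of_not_mem P.jM P.jB hy h1 hc, ΨRad] at hN
        simp only [neg_neg] at hN
        rw [Real.exp_log hX] at hN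
        refine Or.inl ⟨y, ⟨hguard, ?_⟩, rfl⟩
        exact (E.levelFun_le_of_le_ξ hy h1 hN₀pos hN).trans (by simp only [hs₀]; linarith [le_max_left s₁ s₂])
    · -- cocore branch: `N = ψ Y`
      rw [← hwz] at hN ⊢
      have hw' : κ w ≠ 0 := TubeNbhd.univBall_ne_zero hw
      have hr : 0 < ‖κ w‖ := norm_pos_iff.2 hw'
      have hYy : 0 < Real.log (2 / ‖κ w‖) := Real.log_pos ((lt_div_iff₀ hr).2 (by linarith [TubeNbhd.norm_univBall_lt w]))
      have hψ : 0 < TraceCollar.ψ (Real.log (2 / ‖κ w‖)) := TraceCollar.ψ_pos hYy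
      rw [E.collarInv_inr_zero, TubeNbhd.ΨFlat] at hN
      simp only [neg_neg] at hN
      rw [show TubeNbhd.radF ((0 : EuclideanSpace ℝ (Fin 2)), w) = ‖κ w‖ from rfl, Real.exp_log hψ] at hN
      have hYb : Y₁ ≤ Real.log (2 / ‖κ w‖) := by
        by_contra h
        rw [not_le] at h
        have := TraceCollar.strictMonoOn_ψ hYy.le hY₁pos.le h
        linarith
      have hwr : ‖κ w‖ ≤ r₁ := by
        rw [← TubeNbhd.two_mul_exp_neg_log hr, hr₁]
        gcongr
      refine Or.inr ⟨(0, w), ⟨by simp, ⟨κ w, ?_, ?_⟩⟩, rfl⟩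
      · rw [Metric.mem_closedBall, dist_zero_right]; exact hwr
      · exact TubeNbhd.univBall_symm_apply_apply w

end SmoothPresentation

end EndDatum

end FriendsTk

/-- **Helper `helper_friendsCarrier_Tk_endCompact`** (registered on the crux item; end collar part 9 of
stub `helper_friendsCarrier_Tk`): under the hypotheses of `helper_friendsCarrier_Tk`, the end collar `c` of
the relative open trace has range exactly the complement of the core `C = i(D_k) ∪ f₀(𝔻²)`, and
`C ∪ c(Y × (-∞, a])` is compact for every `a` (the collar is proper towards the core; Kirby 1989, Ch. I §5).
[cite: Kirby1989, Ch. I §5] -/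
theorem helper_friendsCarrier_Tk_endCompact : ∀ (k : ℕ) (K₀ : (sphere (0 : EuclideanSpace ℝ (Fin 2)) 1) → EuclideanSpace ℝ (Fin 4)), IsModelKnot k K₀ → ∀ (Y : Type) [TopologicalSpace Y] [T2Space Y] [SecondCountableTopology Y] [ChartedSpace (EuclideanSpace ℝ (Fin 3)) Y] [IsManifold (𝓡 3) ∞ Y] (jB : solidTorus → Y) (μ₀ : C((sphere (0 : EuclideanSpace ℝ (Fin 2)) 1), Y)) (νK : (sphere (0 : EuclideanSpace ℝ (Fin 2)) 1) × EuclideanSpace ℝ (Fin 2) → EuclideanSpace ℝ (Fin 4)) (jM : EuclideanSpace ℝ (Fin 4) → Y) (W : Set (EuclideanSpace ℝ (Fin 4))) (ψ : Y → EuclideanSpace ℝ (Fin 4)), (Manifold.IsSmoothEmbedding (𝓘(ℝ, EuclideanSpace ℝ (Fin 2)).prod (𝓡 1)) (𝓡 3) ∞ jB ∧ IsOpen (range jB) ∧ ContMDiff ((𝓡 1).prod 𝓘(ℝ, EuclideanSpace ℝ (Fin 2))) 𝓘(ℝ, EuclideanSpace ℝ (Fin 4)) ∞ νK ∧ Injective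 νK ∧ (∀ p, Injective (mfderiv ((𝓡 1).prod 𝓘(ℝ, EuclideanSpace ℝ (Fin 2))) 𝓘(ℝ, EuclideanSpace ℝ (Fin 4)) νK p)) ∧ (∀ p, νK p ∈ modelBoundary k) ∧ (∀ u : (sphere (0 : EuclideanSpace ℝ (Fin 2)) 1), νK (u, 0) = K₀ u) ∧ IsOpen W ∧ (∀ x ∈ modelBoundary k, x ∉ range K₀ → x ∈ W) ∧ ContMDiffOn 𝓘(ℝ, EuclideanSpace ℝ (Fin 4)) (𝓡 3) ∞ jM W ∧ IsOpen (jM '' {x : EuclideanSpace ℝ (Fin 4) | x ∈ modelBoundary k ∧ x ∉ range K₀}) ∧ ContMDiffOn (𝓡 3) 𝓘(ℝ, EuclideanSpace ℝ (Fin 4)) ∞ ψ (jM '' {x : EuclideanSpace ℝ (Fin 4) | x ∈ modelBoundary k ∧ x ∉ range K₀}) ∧ (∀ x ∈ modelBoundary k, x ∉ range K₀ → ψ (jM x) = x) ∧ jM '' {x : EuclideanSpace ℝ (Fin 4) | x ∈ modelBoundary k ∧ x ∉ range K₀} ∪ range jB = univ ∧ (∀ x ∈ modelBoundary k, x ∉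 range K₀ → ∀ b : solidTorus, jM x = jB b ↔ ∃ (u : (sphere (0 : EuclideanSpace ℝ (Fin 2)) 1)) (t : ℝ), t ∈ Ioo (0 : ℝ) 1 ∧ b.1.1 = t • (u : EuclideanSpace ℝ (Fin 2)) ∧ x = νK (u, t • (b.1.2 : EuclideanSpace ℝ (Fin 2))))) → ∃ (X : Type) (_ : TopologicalSpace X) (_ : T2Space X) (_ : ChartedSpace (EuclideanSpace ℝ (Fin 4)) X) (_ : IsManifold (𝓡 4) ∞ X) (i : EuclideanSpace ℝ (Fin 4) → X) (f₀ : EuclideanSpace ℝ (Fin 2) → X) (c : Y × ℝ → X), range c = (i '' modelHandlebody k ∪ f₀ '' closedBall (0 : EuclideanSpace ℝ (Fin 2)) 1)ᶜ ∧ (∀ a : ℝ, IsCompact ((i '' modelHandlebody k ∪ f₀ '' closedBall (0 : EuclideanSpace ℝ (Fin 2)) 1) ∪ c '' {p | p.2 ≤ a})) := by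
  intro k K₀ _ Y _ _ _ _ _ jB μ₀ νK jM W ψ ⟨h1, h2, h3, h4, h5, h6, h7, h8, h9, h10, h11, h12, h13, h14, h15⟩
  let E : FriendsTk.EndDatum k := FriendsTk.EndDatum.endDatumOf h3 h4 h5 h6 h7
  let P : E.SmoothPresentation Y := FriendsTk.EndDatum.smoothPresentationOf h3 h4 h5 h6 h7 h1 h2 h8 h9 h10 h11 h12 h13 h14 h15
  exact ⟨E.Trace, inferInstance, inferInstance, inferInstance, inferInstance, E.incl, E.coreDisc, E.collar P.jM P.jB P.ψ,
    P.range_collar, P.isCompact_trCore_union_image_le⟩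

end Summit.SmoothPoincare4.SmoothPoincare4.Theorems.DcrGap.MkFriends

end
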